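import Literature.Analysis.FluidPDE.ClassicalSolution
import Literature.Analysis.FluidPDE.SpaceTimeCalculus
import Literature.Analysis.FluidPDE.LerayProfileCalculus
import Literature.Analysis.FluidPDE.AncientSimilarityVariables
import HarnessLib

/-!
# Crux `NoTypeIBlowup` (stmt-NavierStokesRegularity-1217), line `head-flux-channel`:
  FL3, the transport identity of the radial Reynolds scalar `ψ = ⟪x, u⟫`
  (`radialReynoldsTransport`, lead-sanctioned helper for STUB S4 `stub_headInfluxLaw`)

Lead prover `prover-line-stmt-NavierStokesRegularity-1217-0`, 2026-08-16 (derivation CAS-checked by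
the crux refuter, job j012896). For a classical solution `(u, p)` of the forced incompressible
Navier–Stokes system `∂ₜu + (u·∇)u = νΔu − ∇p + f`, `div u = 0` on `S × E`
(`IsClassicalNSSolutionOn S ν f u p`, `E` a finite-dimensional real inner product space), the
**radial Reynolds scalar** `ψ(t, x) := ⟪x, u(t, x)⟫` satisfies, pointwise on `S × E`,

  `∂ₜψ + (u·∇)ψ − νΔψ = ‖u‖² − ⟪x, ∇p⟫ + ⟪x, f⟫`

(`radialReynolds_transport_force`; the registered `ℝ³`, `f = 0` form is
`radialReynoldsTransport`). Proof: `∂ₜψ = ⟪x, ∂ₜu⟫` (`timeDerivWithin_inner_id`);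
`D(⟪·, u t ·⟫)(x) v = ⟪v, u⟫ + ⟪x, Du(x) v⟫`, so `(u·∇)ψ = ‖u‖² + ⟪x, (u·∇)u⟫`
(`fderiv_inner_id_apply`); `Δψ = ⟪x, Δu⟫ + 2 div u = ⟪x, Δu⟫` (the tree's
`laplacian_inner_id_eq`, `div u = 0`); insert the momentum equation.

In Leray's similarity variables (`IsBackwardLeraySolutionOn univ ν U P`: classical Navier–Stokes with
Leray's drift force `−½(U + (y·∇)U)`), the drift contributes `⟪y, f⟫ = −½⟪y, U⟫ − ½⟪y, DU(y) y⟫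
= −½ (y·∇)ψ` EXACTLY (the zero-order terms cancel), whence
`(∂ₛ + ½ y·∇ + U·∇ − νΔ)⟪y, U⟫ = ‖U‖² − ⟪y, ∇P⟫` (`radialReynolds_transport_leray`).

## Conventions

Those of `IsClassicalNSSolutionOn`: one-sided time derivative `timeDerivWithin S` (Mathlib
`derivWithin`), `(u·∇)φ (x) = Dφ(x)[u x] = fderiv ℝ φ x (u x)` (`convect`), `Δ` = Mathlib's
`Laplacian.laplacian` (instance `InnerProductSpace.instLaplacian`, also for scalar functions),
`∇p = gradient (p t)`. **No `UniqueDiffOn ℝ S` hypothesis is needed**: at a time `t ∈ S` of unique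
differentiability the product rule `HasDerivWithinAt.inner` computes `derivWithin` of `s ↦ ⟪x, u s x⟫`
(the time line is differentiable within `S` by joint smoothness,
`IsSmoothSpaceTimeOn.differentiableWithinAt_time`), and at any other `t` BOTH one-sided derivatives
are Mathlib's junk value `0` (`derivWithin_zero_of_not_uniqueDiffWithinAt`), so `∂ₜψ = ⟪x, ∂ₜu⟫`
holds unconditionally, and the momentum equation is used as the structure field states it.

Everything is folklore calculus over Mathlib (`HasDerivWithinAt.inner`, `fderiv_inner_apply`) and the
tree (`laplacian_inner_id_eq`, `IsSmoothSpaceTimeOn.differentiableWithinAt_time`); fully proved, no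
named facts, no definitions. Lands `--supports stmt-NavierStokesRegularity-1217`.
-/

noncomputable section

namespace Summit.NavierStokesRegularity.NavierStokesRegularity.Theorems.HeadFluxChannelFL3

open MeasureTheory Set Filter Topology
open scoped RealInnerProductSpace Laplacian ContDiff
open Literature.Analysis.FluidPDE

variable {E : Type*} [NormedAddCommGroup E] [InnerProductSpace ℝ E]

/-- **`∂ₜ⟪x, u⟫ = ⟪x, ∂ₜu⟫` for the one-sided time derivative within any time set `S`**, at a
time where the time line `s ↦ u s x` is differentiable within `S` (no unique differentiability
needed: where it fails both sides are the junk value `0`). [folklore] -/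
theorem timeDerivWithin_inner_id (S : Set ℝ) (u : ℝ → E → E) {t : ℝ} (x : E)
    (hu : DifferentiableWithinAt ℝ (fun s => u s x) S t) :
    timeDerivWithin S (fun s y => ⟪y, u s y⟫) t x = ⟪x, timeDerivWithin S u t x⟫ := by
  rw [timeDerivWithin_apply, timeDerivWithin_apply]
  by_cases hU : UniqueDiffWithinAt ℝ S t
  · have h := (hasDerivWithinAt_const t S x).inner ℝ hu.hasDerivWithinAt
    rw [h.derivWithin hU, inner_zero_left, add_zero]
  · rw [derivWithin_zero_of_not_uniqueDiffWithinAt hU,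
      derivWithin_zero_of_not_uniqueDiffWithinAt hU, inner_zero_right]

/-- **`D(⟪·, v ·⟫)(x) a = ⟪a, v x⟫ + ⟪x, Dv(x) a⟫`** at a point of differentiability of `v`
(Mathlib `fderiv_inner_apply` with the identity as first factor). [folklore] -/
theorem fderiv_inner_id_apply {v : E → E} {x : E} (hv : DifferentiableAt ℝ v x) (a : E) :
    fderiv ℝ (fun y => ⟪y, v y⟫) x a = ⟪a, v x⟫ + ⟪x, fderiv ℝ v x a⟫ := by
  have hid : DifferentiableAt ℝ (fun y : E => y) x := differentiableAt_id
  rw [fderiv_inner_apply ℝ hid hv a, fderiv_fun_id, add_comm]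
  rfl

variable [FiniteDimensional ℝ E]

/-- **The radial Reynolds transport identity, forced form.** For a classical solution of
`∂ₜu + (u·∇)u = νΔu − ∇p + f`, `div u = 0` on `S × E` and `ψ(t, x) = ⟪x, u(t, x)⟫`:
`∂ₜψ + (u·∇)ψ − νΔψ = ‖u‖² − ⟪x, ∇p⟫ + ⟪x, f⟫` at every `t ∈ S`, `x : E`
(`∂ₜψ = ⟪x, ∂ₜu⟫`, `(u·∇)ψ = ‖u‖² + ⟪x, (u·∇)u⟫`, `Δψ = ⟪x, Δu⟫ + 2 div u = ⟪x, Δu⟫`, and the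
momentum equation). [folklore] -/
theorem radialReynolds_transport_force {S : Set ℝ} {ν : ℝ} {f u : ℝ → E → E} {p : ℝ → E → ℝ}
    (h : IsClassicalNSSolutionOn S ν f u p) {t : ℝ} (ht : t ∈ S) (x : E) :
    timeDerivWithin S (fun s y => ⟪y, u s y⟫) t x + fderiv ℝ (fun y => ⟪y, u t y⟫) x (u t x)
        - ν * (Δ fun y => ⟪y, u t y⟫) x =
      ‖u t x‖ ^ 2 - ⟪x, gradient (p t) x⟫ + ⟪x, f t x⟫ := by
  have hC : ContDiff ℝ ∞ (u t) := h.contDiff_velocity ht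
  have hC2 : ContDiff ℝ 2 (u t) := hC.of_le (by norm_cast)
  have hd : DifferentiableAt ℝ (u t) x := (hC.differentiable (by simp)) x
  -- `∂ₜψ = ⟪x, ∂ₜu⟫`
  have hT := timeDerivWithin_inner_id S u x (h.smooth_velocity.differentiableWithinAt_time ht x)
  -- `(u·∇)ψ = ‖u‖² + ⟪x, (u·∇)u⟫`
  have hD : fderiv ℝ (fun y => ⟪y, u t y⟫) x (u t x) =
      ‖u t x‖ ^ 2 + ⟪x, convect (u t) (u t) x⟫ := by
    rw [fderiv_inner_id_apply hd, convect_apply, real_inner_self_eq_norm_sq]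
  -- `Δψ = ⟪x, Δu⟫` (the cross term `2 div u` vanishes)
  have hL : (Δ fun y => ⟪y, u t y⟫) x = ⟪x, (Δ (u t)) x⟫ := by
    rw [laplacian_inner_id_eq hC2 x, h.divFree t ht x, mul_zero, add_zero]
  -- the momentum equation, solved for `∂ₜu`
  have etd : timeDerivWithin S u t x =
      ν • (Δ (u t)) x - gradient (p t) x + f t x - convect (u t) (u t) x := by
    rw [← h.momentum t ht x]; abel
  rw [hT, hD, hL, etd]
  simp only [inner_sub_right, inner_add_right, real_inner_smul_right]
  ring

/-- **The radial Reynolds transport identity in Leray's similarity variables.** For a classical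
solution `(U, P)` of the backward Leray system `∂ₛU + ½U + ½(y·∇)U + (U·∇)U + ∇P = νΔU`,
`div U = 0` on `ℝ × E` (`IsBackwardLeraySolutionOn univ ν U P`) and `ψ(s, y) = ⟪y, U(s, y)⟫`:
`∂ₛψ + ½ (y·∇)ψ + (U·∇)ψ − νΔψ = ‖U‖² − ⟪y, ∇P⟫` — the drift force `−½(U + (y·∇)U)` paired
with `y` is exactly `−½ (y·∇)ψ = −½(⟪y, U⟫ + ⟪y, DU(y) y⟫)`. [folklore] -/
theorem radialReynolds_transport_leray {ν : ℝ} {U : ℝ → E → E} {P : ℝ → E → ℝ}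
    (h : IsBackwardLeraySolutionOn univ ν U P) (s : ℝ) (y : E) :
    deriv (fun σ => ⟪y, U σ y⟫) s + (1 / 2 : ℝ) * fderiv ℝ (fun z => ⟪z, U s z⟫) y y
        + fderiv ℝ (fun z => ⟪z, U s z⟫) y (U s y) - ν * (Δ fun z => ⟪z, U s z⟫) y =
      ‖U s y‖ ^ 2 - ⟪y, gradient (P s) y⟫ := by
  have key := radialReynolds_transport_force h (mem_univ s) y
  rw [timeDerivWithin_apply, derivWithin_univ, rescaledEulerLerayForce_apply] at key
  have hd : DifferentiableAt ℝ (U s) y :=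
    ((h.contDiff_velocity (mem_univ s)).differentiable (by simp)) y
  rw [fderiv_inner_id_apply hd y]
  simp only [inner_neg_right, real_inner_smul_right, inner_add_right] at key
  linear_combination key

end Summit.NavierStokesRegularity.NavierStokesRegularity.Theorems.HeadFluxChannelFL3

namespace Summit.NavierStokesRegularity.NavierStokesRegularity.Theorems

open MeasureTheory Set Filter Topology
open scoped RealInnerProductSpace Laplacian
open Literature.Analysis.FluidPDE

/-- **Registered helper `radialReynoldsTransport`** (FL3 of the idea card, the equation-specific
handle for STUB S4 `stub_headInfluxLaw` of line `head-flux-channel`): for a classical solution of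
unforced Navier–Stokes `∂ₜu + (u·∇)u = νΔu − ∇p`, `div u = 0` on `S × ℝ³` (any time set `S`, any
viscosity `ν`), the radial Reynolds scalar `ψ(t, x) = ⟪x, u(t, x)⟫` satisfies
`∂ₜψ + (u·∇)ψ − νΔψ = ‖u‖² − ⟪x, ∇p⟫` pointwise on `S × ℝ³`
(`HeadFluxChannelFL3.radialReynolds_transport_force` with `f = 0`; no `UniqueDiffOn` hypothesis,
see the module docstring). [folklore] -/
theorem radialReynoldsTransport :
    ∀ (S : Set ℝ) (ν : ℝ) (u : ℝ → EuclideanSpace ℝ (Fin 3) → EuclideanSpace ℝ (Fin 3)) (p : ℝ → EuclideanSpace ℝ (Fin 3) → ℝ), Literature.Analysis.FluidPDE.IsClassicalNSSolutionOn S ν 0 u p → ∀ t ∈ S, ∀ x : EuclideanSpace ℝ (Fin 3), Literature.Analysis.FluidPDE.timeDerivWithin S (fun s y => inner ℝ y (u s y)) t x + fderiv ℝ (fun y => inner ℝ y (u t y)) x (u t x) - ν * Laplacian.laplacian (fun y => inner ℝ y (u t y)) x = ‖u t x‖ ^ 2 - inner ℝ x (gradient (p t) x) := by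
  intro S ν u p h t ht x
  have key := HeadFluxChannelFL3.radialReynolds_transport_force h ht x
  rw [Pi.zero_apply, Pi.zero_apply, inner_zero_right, add_zero] at key
  exact key

end Summit.NavierStokesRegularity.NavierStokesRegularity.Theorems

end
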